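import Summits.CriticalPhenomena.SAWScalingLimit.Theorems.SAWDevelopingMapNoFoldBoundSourceAdjClasses
import Summits.CriticalPhenomena.SAWScalingLimit.Theorems.SAWDevelopingMapNoFoldBoundSourceAdjPort
import Summits.CriticalPhenomena.SAWScalingLimit.Theorems.SAWDevelopingMapNoFoldBoundBoundaryLayer
import Summits.CriticalPhenomena.SAWScalingLimit.Theorems.SAWDevelopingMapNoFoldBoundInteriorPointwise
import Summits.CriticalPhenomena.SAWScalingLimit.Theorems.SAWDevelopingMapNoFoldBoundWalledPorts
import Summits.CriticalPhenomena.SAWScalingLimit.Theorems.SAWDevelopingMapNoFoldBoundAlgebra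
import Summits.CriticalPhenomena.SAWScalingLimit.Theorems.SAWDevelopingMapNoFoldBoundPortRenewal
import Summits.CriticalPhenomena.SAWScalingLimit.Theorems.SAWDevelopingMapNoFoldBoundSlitSC

/-!
# `NoFoldBound`, line Ideator3Sketch — the whole boundary collar of depth ≤ 2 from two named inputs

Crux `NoFoldBound` (stmt-CriticalPhenomena-8296), route `SAWDevelopingMap`, lead seat c4. A citable milestone of the line:
the no-fold inequality of the crux holds, with ONE constant `k < 1`, at every vertex `v` of every simply connected
domain that lies within lattice distance `2` of the complement — `v` on the source mid-edge, `v` with a neighbour outside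
`Λ` (depth 1), or `v` with a second neighbour outside `Λ` (depth 2, both positions of the touching neighbour: off the
source and equal to the source vertex) — GIVEN the two quantitative inputs of the skeleton:

* `hL`  — the slit returning-loop series is `≤ 1/5` (registered stub `stub_slitLoopFifth`; numerically `sup = 0.1175`);
* `hdom`, `hdomSrc` — middle-port dominance of the dressed first-arrival masses at depth-2 vertices, touching neighbour
  off the source / equal to the source vertex (registered stubs `stub_portDominance`, `stub_portDominanceSrc`;
  numerically the ratio is `≥ 2.6` at every scale probed).

Everything else is a theorem of the tree: the boundary layer (`boundaryLayer_of_hyps` with `stub_walledPorts`,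
`stub_algebra`; it needs `SourceLoopBound`, which `hL` implies since `1/5 < sin(π/8)`), the
depth-2 stratum (`depthTwo_coherence`), the source-adjacent stratum (`sourceAdj_coherence` with the landed classes
`stub_sourceAdjClasses`), and the pointwise interior reduction (`interior_labellings_at` with `stub_portRenewal`,
`stub_slitSC`). Result: `noFold_collarTwo`. What remains of the crux beyond this file is depth ≥ 3 (the skeleton's
`stub_collarDepthThree`) and the deep vertices (`InteriorFlattening`). [folklore assembly]
-/

noncomputable section

open scoped BigOperators
open Literature.Probability.LatticeModels Literature.Probability.RandomPlanarGeometry.SAW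

namespace Summit.CriticalPhenomena.SAWScalingLimit.Theorems.SAWDevelopingMapNoFoldBound

/-- `1/5 < sin(π/8)` (`sin x > x − x³/6` for `x > 0`, `3.14 < π < 3.15`). [folklore] -/
theorem one_fifth_lt_sin_pi_div_eight : (1 / 5 : ℝ) < Real.sin (Real.pi / 8) := by
  have hπ₁ := Real.pi_gt_d2
  have hπ₂ := Real.pi_lt_d2
  have hx0 : 0 < Real.pi / 8 := by positivity
  have hs : Real.pi / 8 - (Real.pi / 8) ^ 3 / 6 < Real.sin (Real.pi / 8) := Real.sin_gt_sub_cube hx0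
  have hcube : (Real.pi / 8) ^ 3 ≤ (3.15 / 8 : ℝ) ^ 3 :=
    pow_le_pow_left₀ hx0.le (by linarith) 3
  nlinarith [hs, hcube]

/-- **The boundary collar of depth ≤ 2 never folds, given the two named inputs.** Under (hL) slit loops `≤ 1/5`,
(hdom) middle-port dominance at depth-2 vertices with the touching neighbour off the source and (hdomSrc) the same with
the source vertex as touching neighbour, there is one `k < 1` such that for every simply connected `Λ`, every source
`a ∈ ∂Ω`, every vertex `v ∈ Λ` within lattice distance `2` of the complement (on `a`, or with a neighbour outside, or with
a neighbour that has a neighbour `≠ v` outside) and every labelling `w₀, w₁, w₂` of its neighbours,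
`‖F{v,w₀} + ωF{v,w₁} + ω²F{v,w₂}‖ ≤ k‖F{v,w₀} + F{v,w₁} + F{v,w₂}‖`, `F = hexParafermionicObservable Λ a x_c (5/8)`.
[folklore assembly] -/
theorem noFold_collarTwo
    (hL : ∀ (Λ : Finset HexVertex), hexDomainSimplyConnected Λ →
      ∀ u v w₁ w₂ : HexVertex, u ∉ Λ → v ∈ Λ → hexGraph.Adj v u → hexGraph.Adj v w₁ →
        hexGraph.Adj v w₂ → u ≠ w₁ → u ≠ w₂ → w₁ ≠ w₂ →
        (∑ γ : HexMidEdgeSAW (Λ.erase v) s(v, w₁) s(v, w₂), hexCriticalFugacity ^ γ.length) ≤ 1 / 5)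
    (hdom : ∀ (Λ : Finset HexVertex), hexDomainSimplyConnected Λ → ∀ a ∈ hexDomainBoundary Λ,
      ∀ v ∈ Λ, v ∉ a → ∀ w₀ w₁ w₂ x y : HexVertex, hexGraph.Adj v w₀ → hexGraph.Adj v w₁ →
      hexGraph.Adj v w₂ → w₀ ≠ w₁ → w₁ ≠ w₂ → w₀ ≠ w₂ → w₀ ∈ Λ → w₀ ∉ a →
      winding [hexMidpoint s(w₀, v), hexCenter v, hexMidpoint s(v, w₁)] = Real.pi / 3 →
      hexGraph.Adj w₀ x → hexGraph.Adj w₀ y → v ≠ x → x ≠ y → v ≠ y → x ∉ Λ →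
      let xc : ℝ := hexCriticalFugacity
      let α : ℝ := 1 + 2 * hexCriticalFugacity * Real.cos (5 * Real.pi / 24)
      let s : (w p q : HexVertex) → ℝ := fun w p q =>
        ∑ γ : HexMidEdgeSAW Λ a s(v, w), if v ∉ γ.verts then xc ^ γ.length *
          (α - Real.sqrt 3 * xc *
            ∑ δ : HexMidEdgeSAW ((Λ \ γ.verts.toFinset).erase v) s(v, p) s(v, q), xc ^ δ.length) else 0
      (winding [hexMidpoint s(y, w₀), hexCenter w₀, hexMidpoint s(w₀, v)] = Real.pi / 3 →
          min (s w₀ w₁ w₂) (s w₂ w₀ w₁) ≤ s w₁ w₂ w₀) ∧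
        (winding [hexMidpoint s(y, w₀), hexCenter w₀, hexMidpoint s(w₀, v)] = -(Real.pi / 3) →
          min (s w₀ w₁ w₂) (s w₁ w₂ w₀) ≤ s w₂ w₀ w₁))
    (hdomSrc : ∀ (Λ : Finset HexVertex), hexDomainSimplyConnected Λ → ∀ a ∈ hexDomainBoundary Λ,
      ∀ v ∈ Λ, v ∉ a → ∀ w₀ w₁ w₂ x y : HexVertex, hexGraph.Adj v w₀ → hexGraph.Adj v w₁ →
      hexGraph.Adj v w₂ → w₀ ≠ w₁ → w₁ ≠ w₂ → w₀ ≠ w₂ → w₀ ∈ Λ → a = s(x, w₀) →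
      winding [hexMidpoint s(w₀, v), hexCenter v, hexMidpoint s(v, w₁)] = Real.pi / 3 →
      hexGraph.Adj w₀ x → hexGraph.Adj w₀ y → v ≠ x → x ≠ y → v ≠ y → x ∉ Λ →
      let xc : ℝ := hexCriticalFugacity
      let α : ℝ := 1 + 2 * hexCriticalFugacity * Real.cos (5 * Real.pi / 24)
      let s : (w p q : HexVertex) → ℝ := fun w p q =>
        ∑ γ : HexMidEdgeSAW Λ a s(v, w), if v ∉ γ.verts then xc ^ γ.length *
          (α - Real.sqrt 3 * xc *
            ∑ δ : HexMidEdgeSAW ((Λ \ γ.verts.toFinset).erase v) s(v, p) s(v, q), xc ^ δ.length) else 0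
      (winding [hexMidpoint s(y, w₀), hexCenter w₀, hexMidpoint s(w₀, v)] = Real.pi / 3 →
          min (s w₀ w₁ w₂) (s w₂ w₀ w₁) ≤ s w₁ w₂ w₀) ∧
        (winding [hexMidpoint s(y, w₀), hexCenter w₀, hexMidpoint s(w₀, v)] = -(Real.pi / 3) →
          min (s w₀ w₁ w₂) (s w₁ w₂ w₀) ≤ s w₂ w₀ w₁)) :
    ∃ k : ℝ, k < 1 ∧ ∀ (Λ : Finset HexVertex), hexDomainSimplyConnected Λ →
      ∀ a ∈ hexDomainBoundary Λ, ∀ v ∈ Λ,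
      (v ∈ a ∨ (∃ u : HexVertex, hexGraph.Adj v u ∧ u ∉ Λ) ∨
        ∃ w x : HexVertex, hexGraph.Adj v w ∧ hexGraph.Adj w x ∧ x ≠ v ∧ x ∉ Λ) →
      ∀ w₀ w₁ w₂ : HexVertex, hexGraph.Adj v w₀ → hexGraph.Adj v w₁ → hexGraph.Adj v w₂ →
      w₀ ≠ w₁ → w₁ ≠ w₂ → w₀ ≠ w₂ →
      let F : Sym2 HexVertex → ℂ := hexParafermionicObservable Λ a hexCriticalFugacity (5 / 8)
      let ω : ℂ := Complex.exp (2 * Real.pi * Complex.I / 3)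
      ‖F s(v, w₀) + ω * F s(v, w₁) + ω ^ 2 * F s(v, w₂)‖ ≤
        k * ‖F s(v, w₀) + F s(v, w₁) + F s(v, w₂)‖ := by
  have hSLB : Summit.CriticalPhenomena.SAWScalingLimit.Theses.SAWDevelopingMap.SourceLoopBound :=
    ⟨1 / 5, one_fifth_lt_sin_pi_div_eight, hL⟩
  obtain ⟨k₁, hk₁, H₁⟩ := boundaryLayer_of_hyps stub_walledPorts stub_algebra.1 stub_algebra.2 hSLB
  refine ⟨max (max k₁ (19 / 20)) 0, max_lt (max_lt hk₁ (by norm_num)) one_pos, ?_⟩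
  intro Λ hΛ a ha v hv hpos w₀ w₁ w₂ h₀ h₁ h₂ h₀₁ h₁₂ h₀₂
  by_cases hb : v ∈ a ∨ ∃ u : HexVertex, hexGraph.Adj v u ∧ u ∉ Λ
  · -- the boundary layer (source vertex ∪ walled vertices)
    have h := H₁ Λ hΛ a ha v hv hb w₀ w₁ w₂ h₀ h₁ h₂ h₀₁ h₁₂ h₀₂
    dsimp only at h ⊢
    exact h.trans (mul_le_mul_of_nonneg_right
      ((le_max_left k₁ (19 / 20)).trans (le_max_left (max k₁ (19 / 20)) 0)) (norm_nonneg _))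
  · -- interior vertices of depth two
    push Not at hb
    have hva : v ∉ a := hb.1
    have hint : ∀ u : HexVertex, hexGraph.Adj v u → u ∈ Λ := fun u hu => hb.2 u hu
    obtain ⟨w, x, hvw, hwx, hxv, hx⟩ : ∃ w x : HexVertex, hexGraph.Adj v w ∧ hexGraph.Adj w x ∧ x ≠ v ∧ x ∉ Λ := by
      rcases hpos with h | h | h
      · exact absurd h hva
      · obtain ⟨u, hu, huΛ⟩ := h
        exact absurd (hint u hu) huΛ
      · exact h
    refine interior_labellings_at stub_portRenewal stub_slitSC hΛ ha hv hva ?_ h₀ h₁ h₂ h₀₁ h₁₂ h₀₂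
    intro p q r hp hq hr hpq hqr hpr hchir
    by_cases hwa : w ∈ a
    · -- the touching neighbour is the source vertex
      have h := sourceAdj_coherence hL stub_sourceAdjClasses hdomSrc hΛ ha hv hva hint ⟨w, hvw, hwa⟩ hp hq hr
        hpq hqr hpr hchir
      dsimp only at h ⊢
      exact h.trans (mul_le_mul_of_nonneg_right (le_max_right k₁ (19 / 20)) (norm_nonneg _))
    · -- the touching neighbour is off the source: the depth-2 theorem
      have h := depthTwo_coherence hL hdom hΛ ha hv hva hint ⟨w, x, hvw, hwx, hxv, hx, hwa⟩ hp hq hr hpq hqr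
        hpr hchir
      dsimp only at h ⊢
      exact h.trans (mul_le_mul_of_nonneg_right (le_max_right k₁ (19 / 20)) (norm_nonneg _))

end Summit.CriticalPhenomena.SAWScalingLimit.Theorems.SAWDevelopingMapNoFoldBound

end
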